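import Summits.CriticalPhenomena.PercolationContinuityZ3.Theorems.PercNearOneGluingNoHeavyLowerTailCILStrongRelayNeighbours
import HarnessLib

/-!
# `NoHeavyLowerTail` (stmt-CriticalPhenomena-4575) — SINGLE-PORT DOMINATION: the T-form witness set of a relay-neighboured observer

Support file (lemma factory #8 `prim-lf-8`, gen 3; `--supports stmt-CriticalPhenomena-4575`).  No definitions, no named facts, no sorries.
Setting of `Theorems.cil_relayNeighbours_strong` (prover `prim-hp-2`): `μ = prodBernoulli w` on `Fin n`, relays `A`, observer `o ∉ A` whose
positive-weight neighbours are among the ports `p 0, …, p (d−1) ∈ A` (injective), `H = G − o` read on `ω ∩ {e | o ∉ e}`; write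
`Φ_G(x) = μ{|π(x)| ≤ j}` (lightness in `G`) and `Φ_H(x) = μ{|π_H(x)| ≤ j}` (lightness with the observer's edges ignored).  The T-FORM
(guarded / pre-FKG cumulative isolation) with witness `x` is `μ{1 ≤ N ≤ j} ≤ μ({|π(x)| ≤ j} ∩ {some port edge open})`
(for a relay-neighboured observer `{some port edge open} = {o ↔ A}` a.s.).

`cil_relayNeighbours_strong` proves the T-form for the port `p i` that is lightest in `H`.  This file enlarges the proved witness set:

* `SinglePortDomination.real_light_inter_allClosed` — for every relay `x`: `μ({|π(x)| ≤ j} ∩ {all port edges closed}) = μ{all closed} · Φ_H(x)`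
  (on the all-closed event the cluster of `x` is its `H`-cluster, and that event is independent of `H`; the proof of
  `lightnessSlack_relayNeighbours` for an arbitrary relay).  Consequently the T-form value of a witness is
  `V(x) := μ({|π(x)| ≤ j} ∩ {some port edge open}) = Φ_G(x) − μ{all closed}·Φ_H(x)` (`real_light_inter_someOpen`), and the T-form witnesses
  are exactly the relays with `V(x) ≥ μ{1 ≤ N ≤ j}` — an up-set of ONE scalar (validity is not monotone in `Φ_G` alone).
* `tform_of_dominates_lightestPort` — **if `p i` is an `H`-lightest port (`Φ_H(p l) ≤ Φ_H(p i)` for all `l`) and a relay `c ∈ A` satisfies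
  `Φ_G(p i) ≤ Φ_G(c)`, then `c` is a T-form witness: `μ{1 ≤ N ≤ j} ≤ μ({|π(c)| ≤ j} ∩ {some port edge open})`.**
  Proof: if `Φ_H(c) ≤ Φ_H(p i)` then `V(c) − V(p i) = [Φ_G(c) − Φ_G(p i)] − μ{all closed}·[Φ_H(c) − Φ_H(p i)] ≥ 0` and `V(p i) ≥ μ{1 ≤ N ≤ j}`
  is `cil_relayNeighbours_strong`; otherwise `c` itself `H`-dominates every port and `cil_relayNeighbours_strong` applies to the port list with
  `c` appended as a port of weight `0` (the extra event `{s(o,c) open}` is null).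
* `tform_of_portDomination` — a relay dominating EVERY port in `G` (`Φ_G(p l) ≤ Φ_G(c)` for all `l`) is a T-form witness: the T-form
  sharpening of `Theorems.cil_of_portDomination` (which concludes only `μ{1 ≤ N ≤ j} ≤ Φ_G(c)`).

Census behind the statement (seat memo `run/shared/lean/prim/prim-lf-8/CANDIDATES.md` §B5-4): 0 violations in 37 176 exact (instance, c) cases,
2 113 of them in the genuinely new case `Φ_H(c) ≤ Φ_H(p i)`; it is the `|S| = 1`, relay-neighboured, zero-deficit case of the gate-domination
candidate QGATE-T (§B5-1).
-/

noncomputable section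

namespace Summit.CriticalPhenomena.PercolationContinuityZ3.Theorems

open MeasureTheory Set Literature.Probability.LatticeModels Literature.Probability.Percolation
open scoped Classical BigOperators

variable {n : ℕ}

namespace SinglePortDomination

open CutObserver in
/-- **Off the ports, a relay's cluster is its `H`-cluster, independently of the ports.**  For a relay-neighboured observer `o` with
ports `p` and a relay `x ∈ A`: `μ({|π(x)| ≤ j} ∩ {∀ l, s(o, p l) closed}) = μ{∀ l, s(o,p l) closed} · μ{|π_H(x)| ≤ j}`. [folklore] -/
theorem real_light_inter_allClosed (w : Sym2 (Fin n) → unitInterval) (A : Finset (Fin n)) (o : Fin n) (j : ℕ) {d : ℕ}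
    (p : Fin d → Fin n) (hoA : o ∉ A) (hobs : ∀ v, w s(o, v) ≠ 0 → ∃ l, v = p l) (x : Fin n) (hxA : x ∈ A) :
    (prodBernoulli w).real ({ω : BondConfig (Fin n) | (A.filter fun y => ω ∈ openConn x y).card ≤ j} ∩
        {ω | ∀ l, s(o, p l) ∉ ω}) =
      (prodBernoulli w).real {ω : BondConfig (Fin n) | ∀ l, s(o, p l) ∉ ω} *
        (prodBernoulli w).real {ω : BondConfig (Fin n) |
          (A.filter fun y => (openGraph (ω ∩ {e | o ∉ e})).Reachable x y).card ≤ j} := by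
  set μ := prodBernoulli w with hμ
  set T := {ω : BondConfig (Fin n) | (A.filter fun y => ω ∈ openConn x y).card ≤ j} with hT
  set C := {ω : BondConfig (Fin n) | ∀ l, s(o, p l) ∉ ω} with hC
  set TH := {ω : BondConfig (Fin n) | (A.filter fun y => (openGraph (ω ∩ {e | o ∉ e})).Reachable x y).card ≤ j} with hTH
  set G := {ω : BondConfig (Fin n) | ∀ e ∈ ω, w e ≠ 0} with hG
  have hxo : x ≠ o := fun h => hoA (h ▸ hxA)
  -- on C ∩ G the cluster of x is its H-cluster (an open edge at o would be a port edge or a weight-0 pair)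
  have hclus : ∀ ω, ω ∈ C → ω ∈ G → (A.filter fun y => ω ∈ openConn x y) =
      (A.filter fun y => (openGraph (ω ∩ {e | o ∉ e})).Reachable x y) := by
    intro ω hC' hG'
    refine Finset.filter_congr fun y _ => ⟨fun h => ?_, fun h => reachable_mono inter_subset_left h⟩
    refine reachable_avoiding_of_not_reachable (fun hio => ?_) h
    obtain ⟨wk⟩ := hio.symm
    cases wk with
    | nil => exact hxo rfl
    | @cons _ v _ hadj _ =>
      rw [openGraph, SimpleGraph.fromEdgeSet_adj] at hadj
      obtain ⟨m, rfl⟩ := hobs v (hG' _ hadj.1)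
      exact hC' m hadj.1
  have hTC : (T ∩ C) ∩ G = (C ∩ TH) ∩ G := by
    ext ω
    simp only [mem_inter_iff]
    constructor
    · rintro ⟨⟨hT', hC'⟩, hG'⟩
      refine ⟨⟨hC', ?_⟩, hG'⟩
      show (A.filter fun y => (openGraph (ω ∩ {e | o ∉ e})).Reachable x y).card ≤ j
      rw [← hclus ω hC' hG']; exact hT'
    · rintro ⟨⟨hC', hTH'⟩, hG'⟩
      refine ⟨⟨?_, hC'⟩, hG'⟩
      show (A.filter fun y => ω ∈ openConn x y).card ≤ j
      rw [hclus ω hC' hG']; exact hTH'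
  -- independence of C (port edges) and TH (edges off o)
  set Ports : Finset (Sym2 (Fin n)) := Finset.univ.image fun l : Fin d => s(o, p l) with hPorts
  set Eo : Finset (Sym2 (Fin n)) := Finset.univ.filter fun e : Sym2 (Fin n) => o ∉ e with hEo
  have hdisj : Disjoint Ports Eo := by
    rw [Finset.disjoint_left]; intro e he he'
    rw [hPorts, Finset.mem_image] at he; obtain ⟨l, -, rfl⟩ := he
    rw [hEo, Finset.mem_filter] at he'; exact he'.2 (Sym2.mem_mk_left _ _)
  have hC_det : DeterminedBy C (↑Ports : Set (Sym2 (Fin n))) := by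
    rw [determinedBy_iff]
    intro ω ω' h
    simp only [hC, mem_setOf_eq]
    refine forall_congr' fun l => ?_
    have hmem : s(o, p l) ∈ (↑Ports : Set (Sym2 (Fin n))) := by
      rw [Finset.mem_coe, hPorts, Finset.mem_image]; exact ⟨l, by simp, rfl⟩
    have := Set.ext_iff.1 h (s(o, p l))
    simp only [mem_inter_iff, hmem, and_true] at this
    rw [this]
  have hTH_det : DeterminedBy TH (↑Eo : Set (Sym2 (Fin n))) := by
    have h := determinedBy_restrict Eo (fun ξ => (A.filter fun y => (openGraph ξ).Reachable x y).card ≤ j)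
    rw [coe_edgesAvoiding] at h
    rw [hEo, coe_edgesAvoiding]; exact h
  have hind : μ.real (C ∩ TH) = μ.real C * μ.real TH :=
    prodBernoulli_real_inter_of_determinedBy_disjoint w hdisj hC_det hTH_det MeasurableSet.of_discrete
      MeasurableSet.of_discrete
  rw [← measureReal_inter_support w (T ∩ C), hTC, measureReal_inter_support, hind]

/-- **The T-form value of a witness.**  `V(x) := μ({|π(x)| ≤ j} ∩ {some port edge open}) = Φ_G(x) − μ{all port edges closed}·Φ_H(x)`
for every relay `x ∈ A` of a relay-neighboured observer. [folklore] -/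
theorem real_light_inter_someOpen (w : Sym2 (Fin n) → unitInterval) (A : Finset (Fin n)) (o : Fin n) (j : ℕ) {d : ℕ}
    (p : Fin d → Fin n) (hoA : o ∉ A) (hobs : ∀ v, w s(o, v) ≠ 0 → ∃ l, v = p l) (x : Fin n) (hxA : x ∈ A) :
    (prodBernoulli w).real ({ω : BondConfig (Fin n) | (A.filter fun y => ω ∈ openConn x y).card ≤ j} ∩
        {ω | ∃ l, s(o, p l) ∈ ω}) =
      (prodBernoulli w).real {ω : BondConfig (Fin n) | (A.filter fun y => ω ∈ openConn x y).card ≤ j} -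
        (prodBernoulli w).real {ω : BondConfig (Fin n) | ∀ l, s(o, p l) ∉ ω} *
          (prodBernoulli w).real {ω : BondConfig (Fin n) |
            (A.filter fun y => (openGraph (ω ∩ {e | o ∉ e})).Reachable x y).card ≤ j} := by
  set μ := prodBernoulli w with hμ
  set T := {ω : BondConfig (Fin n) | (A.filter fun y => ω ∈ openConn x y).card ≤ j} with hT
  set O := {ω : BondConfig (Fin n) | ∃ l, s(o, p l) ∈ ω} with hO
  have hsplit : μ.real T = μ.real (T ∩ O) + μ.real (T \ O) :=
    (measureReal_inter_add_sdiff (MeasurableSet.of_discrete (s := O)) (measure_ne_top _ _)).symm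
  have hdiff : T \ O = T ∩ {ω | ∀ l, s(o, p l) ∉ ω} := by
    ext ω; simp only [hO, mem_sdiff, mem_inter_iff, mem_setOf_eq, not_exists]
  rw [hdiff, real_light_inter_allClosed w A o j p hoA hobs x hxA] at hsplit
  linarith

end SinglePortDomination

open SinglePortDomination CutObserver in
/-- **SINGLE-PORT DOMINATION.**  Relay-neighboured observer `o ∉ A` with ports `p` (injective, every positive-weight neighbour of `o`
is a port), `p i` an `H`-lightest port (`Φ_H(p l) ≤ Φ_H(p i)` for all `l`).  Then EVERY relay `c ∈ A` with `Φ_G(p i) ≤ Φ_G(c)` is a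
T-form witness: `μ{1 ≤ N ≤ j} ≤ μ({|π(c)| ≤ j} ∩ {some port edge open})`.  (`c = p i` is `cil_relayNeighbours_strong` itself.)
[cite: VandenbergHaggstromKahn2005, Thm. 1.5 (p. 7) — only through `cil_relayNeighbours_strong`] -/
theorem tform_of_dominates_lightestPort (w : Sym2 (Fin n) → unitInterval) (A : Finset (Fin n)) (o : Fin n) (j : ℕ) {d : ℕ}
    (p : Fin d → Fin n) (hp : Function.Injective p) (hpA : ∀ l, p l ∈ A) (hoA : o ∉ A)
    (hobs : ∀ v, w s(o, v) ≠ 0 → ∃ l, v = p l) (i : Fin d)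
    (hdom : ∀ l : Fin d,
      (prodBernoulli w).real {ω : BondConfig (Fin n) |
          (A.filter fun x => (openGraph (ω ∩ {e | o ∉ e})).Reachable (p l) x).card ≤ j} ≤
        (prodBernoulli w).real {ω : BondConfig (Fin n) |
          (A.filter fun x => (openGraph (ω ∩ {e | o ∉ e})).Reachable (p i) x).card ≤ j})
    (c : Fin n) (hc : c ∈ A)
    (hG : (prodBernoulli w).real {ω : BondConfig (Fin n) | (A.filter fun x => ω ∈ openConn (p i) x).card ≤ j} ≤
      (prodBernoulli w).real {ω : BondConfig (Fin n) | (A.filter fun x => ω ∈ openConn c x).card ≤ j}) :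
    (prodBernoulli w).real {ω : BondConfig (Fin n) |
        1 ≤ (A.filter fun x => ω ∈ openConn o x).card ∧ (A.filter fun x => ω ∈ openConn o x).card ≤ j} ≤
      (prodBernoulli w).real ({ω : BondConfig (Fin n) | (A.filter fun x => ω ∈ openConn c x).card ≤ j} ∩
        {ω | ∃ l, s(o, p l) ∈ ω}) := by
  set μ := prodBernoulli w with hμ
  have hstrong := cil_relayNeighbours_strong w A o j p hp hpA hoA hobs i hdom
  -- H-lightness of c compared with the H-lightest port
  rcases le_total
      ((prodBernoulli w).real {ω : BondConfig (Fin n) |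
        (A.filter fun x => (openGraph (ω ∩ {e | o ∉ e})).Reachable c x).card ≤ j})
      ((prodBernoulli w).real {ω : BondConfig (Fin n) |
        (A.filter fun x => (openGraph (ω ∩ {e | o ∉ e})).Reachable (p i) x).card ≤ j}) with hle | hge
  · -- case B: Φ_H(c) ≤ Φ_H(p i): compare the two T-form values
    have hVc := real_light_inter_someOpen w A o j p hoA hobs c hc
    have hVp := real_light_inter_someOpen w A o j p hoA hobs (p i) (hpA i)
    have hC0 : 0 ≤ (prodBernoulli w).real {ω : BondConfig (Fin n) | ∀ l, s(o, p l) ∉ ω} := measureReal_nonneg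
    have hprod := mul_le_mul_of_nonneg_left hle hC0
    refine hstrong.trans ?_
    rw [hVc, hVp]
    linarith
  · -- case A: c is H-dominating; if c is a port apply the strong lemma at its index, else append c as a port of weight 0
    by_cases hcp : ∃ m, c = p m
    · obtain ⟨m, rfl⟩ := hcp
      exact cil_relayNeighbours_strong w A o j p hp hpA hoA hobs m fun l => (hdom l).trans hge
    · have hcp' : ∀ m, c ≠ p m := fun m hm => hcp ⟨m, hm⟩
      have hwc : w s(o, c) = 0 := by
        by_contra h
        obtain ⟨l, hl⟩ := hobs c h
        exact hcp' l hl
      -- extended port family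
      set p' : Fin (d + 1) → Fin n := Fin.cons c p with hp'
      have hp'inj : Function.Injective p' := by
        rw [hp', Fin.cons_injective_iff]
        refine ⟨?_, hp⟩
        rintro ⟨l, hl⟩
        exact hcp' l hl.symm
      have hp'A : ∀ l, p' l ∈ A := fun l => by
        refine Fin.cases ?_ (fun m => ?_) l
        · simpa [hp'] using hc
        · simpa [hp'] using hpA m
      have hobs' : ∀ v, w s(o, v) ≠ 0 → ∃ l, v = p' l := fun v hv => by
        obtain ⟨l, rfl⟩ := hobs v hv
        exact ⟨l.succ, by simp [hp']⟩
      have hdom' : ∀ l : Fin (d + 1),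
          (prodBernoulli w).real {ω : BondConfig (Fin n) |
              (A.filter fun x => (openGraph (ω ∩ {e | o ∉ e})).Reachable (p' l) x).card ≤ j} ≤
            (prodBernoulli w).real {ω : BondConfig (Fin n) |
              (A.filter fun x => (openGraph (ω ∩ {e | o ∉ e})).Reachable (p' 0) x).card ≤ j} := fun l => by
        refine Fin.cases ?_ (fun m => ?_) l
        · exact le_rfl
        · simpa [hp'] using (hdom m).trans hge
      have h0 := cil_relayNeighbours_strong w A o j p' hp'inj hp'A hoA hobs' 0 hdom'
      have hp0 : p' 0 = c := by simp [hp']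
      rw [hp0] at h0
      refine h0.trans ?_
      -- the extra port event {s(o,c) open} is null
      have hsub : ({ω : BondConfig (Fin n) | (A.filter fun x => ω ∈ openConn c x).card ≤ j} ∩
          {ω | ∃ l, s(o, p' l) ∈ ω}) ⊆
          ({ω : BondConfig (Fin n) | (A.filter fun x => ω ∈ openConn c x).card ≤ j} ∩ {ω | ∃ l, s(o, p l) ∈ ω}) ∪
            {ω : BondConfig (Fin n) | s(o, c) ∈ ω} := by
        rintro ω ⟨hT, ⟨l, hl⟩⟩
        revert hl
        refine Fin.cases (fun hl => ?_) (fun m hl => ?_) l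
        · right; simpa [hp'] using hl
        · left; exact ⟨hT, ⟨m, by simpa [hp'] using hl⟩⟩
      have hnull : (prodBernoulli w).real {ω : BondConfig (Fin n) | s(o, c) ∈ ω} = 0 := by
        rw [measureReal_open, hwc]; rfl
      calc (prodBernoulli w).real ({ω : BondConfig (Fin n) | (A.filter fun x => ω ∈ openConn c x).card ≤ j} ∩
              {ω | ∃ l, s(o, p' l) ∈ ω})
          ≤ (prodBernoulli w).real (({ω : BondConfig (Fin n) | (A.filter fun x => ω ∈ openConn c x).card ≤ j} ∩
              {ω | ∃ l, s(o, p l) ∈ ω}) ∪ {ω : BondConfig (Fin n) | s(o, c) ∈ ω}) :=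
            measureReal_mono hsub (measure_ne_top _ _)
        _ ≤ (prodBernoulli w).real ({ω : BondConfig (Fin n) | (A.filter fun x => ω ∈ openConn c x).card ≤ j} ∩
              {ω | ∃ l, s(o, p l) ∈ ω}) + (prodBernoulli w).real {ω : BondConfig (Fin n) | s(o, c) ∈ ω} :=
            measureReal_union_le _ _
        _ = _ := by rw [hnull, add_zero]

open SinglePortDomination in
/-- **T-form port domination.**  A relay-neighboured observer and a relay `c ∈ A` dominating every port in `G` (`Φ_G(p l) ≤ Φ_G(c)` for
all `l`, `d ≥ 1`): `μ{1 ≤ N ≤ j} ≤ μ({|π(c)| ≤ j} ∩ {some port edge open})` — the T-form sharpening of `Theorems.cil_of_portDomination`.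
[cite: VandenbergHaggstromKahn2005, Thm. 1.5 (p. 7) — only through `cil_relayNeighbours_strong`] -/
theorem tform_of_portDomination (w : Sym2 (Fin n) → unitInterval) (A : Finset (Fin n)) (o : Fin n) (j : ℕ) {d : ℕ}
    (p : Fin d → Fin n) (hp : Function.Injective p) (hpA : ∀ l, p l ∈ A) (hoA : o ∉ A) (hd : 0 < d)
    (hobs : ∀ v, w s(o, v) ≠ 0 → ∃ l, v = p l) (c : Fin n) (hc : c ∈ A)
    (hdomG : ∀ l : Fin d,
      (prodBernoulli w).real {ω : BondConfig (Fin n) | (A.filter fun x => ω ∈ openConn (p l) x).card ≤ j} ≤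
        (prodBernoulli w).real {ω : BondConfig (Fin n) | (A.filter fun x => ω ∈ openConn c x).card ≤ j}) :
    (prodBernoulli w).real {ω : BondConfig (Fin n) |
        1 ≤ (A.filter fun x => ω ∈ openConn o x).card ∧ (A.filter fun x => ω ∈ openConn o x).card ≤ j} ≤
      (prodBernoulli w).real ({ω : BondConfig (Fin n) | (A.filter fun x => ω ∈ openConn c x).card ≤ j} ∩
        {ω | ∃ l, s(o, p l) ∈ ω}) := by
  set sH : Fin d → ℝ := fun m => (prodBernoulli w).real {ω : BondConfig (Fin n) |
    (A.filter fun x => (openGraph (ω ∩ {e | o ∉ e})).Reachable (p m) x).card ≤ j} with hsH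
  obtain ⟨i, -, hi⟩ := Finset.exists_max_image Finset.univ sH ⟨⟨0, hd⟩, Finset.mem_univ _⟩
  exact tform_of_dominates_lightestPort w A o j p hp hpA hoA hobs i (fun l => hi l (Finset.mem_univ _)) c hc (hdomG i)

end Summit.CriticalPhenomena.PercolationContinuityZ3.Theorems

end
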